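import Summits.NavierStokesRegularity.NavierStokesRegularity.Theses.TypeICertificateLadder
import Summits.NavierStokesRegularity.NavierStokesRegularity.Theorems.TypeICertificateLadderTypeIConcentration
import Summits.NavierStokesRegularity.NavierStokesRegularity.Theorems.RungReynoldsOne.Negative.BudgetCeiling
import Summits.NavierStokesRegularity.NavierStokesRegularity.Theorems.RungReynoldsOne.Negative.WithoutLerayHopfFalse
import Literature.Analysis.FluidPDE.TypeIAncientMild

/-!
# Line `constant-speed-exclusion` for crux `RungReynoldsOne` (item stmt-NavierStokesRegularity-2882,
# route `TypeICertificateLadder`, rung `X_1`) — crux-plan skeleton, round 1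

planner-cruxplan-stmt-NavierStokesRegularity-2882-constant-speed-exclu-0, 2026-08-16.
Idea card `Cruxes/RungReynoldsOne/Ideas/constant-speed-exclusion.md` (ideator 1); triage r1-1 pass,
r1-2 pass, r1-3 pass (all three: "correct, but the Bernoulli/BMO closing is dominated; analyticity and
BMO are print-only; the per-slice time bookkeeping is delicate"). The sharpenings adopted here answer
exactly those three points (see `Lines/constant-speed-exclusion.md`, § Triage answers; this file is published as `Lines/constant_speed_exclusion.lean`):

* the `L^∞`-slack is measured against the RATE BOUND `M(t) = √(ν/(T−t))`, not against `‖u(t)‖_∞`,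
  so the budget is finite by monotonicity of `E(t) = √(T−t)‖∇u(t)‖²₂ ≥ 0` alone (no Leray `H¹` rate,
  no blow-up hypothesis) and its Fatou limit is the SHARP pointwise degeneracy
  `(1/√(−t) − ‖v‖)·|∇v|_F·‖Δv‖ ≡ 0` on the zoom limit (S1, S4);
* the closing uses the route's PROVED uniform Morrey bound `ScaledEnergyBound` (stmt-2884,
  `scaledEnergyBound_proof`), which passes to the zoom limit for ALL radii: a slice of constant speed
  `1/√(−t)`, a constant slice and a harmonic slice all violate `r⁻¹∫_{B_r}‖v‖² ≤ A` unless zero — so the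
  equality-case rigidity is a STATIC per-slice lemma (S6): no Bernoulli head, no BMO, no streamline
  geometry, no bookkeeping of time sets, no forward/backward uniqueness;
* spatial analyticity of Type-I ancient mild slices (S5) is an in-tree `M`-sized consequence of the
  PROVED local analyticity of Oseen's scheme for bounded data
  (`lemarieRieusset2016_local_analyticity_holds`) and uniqueness (`oseenMild_essBounded_unique`);
* non-triviality is the route's PROVED `TypeIConcentration` (stmt-2881, `typeIConcentration_proof`) at
  `C = 1`, consumed at the single slice `t = −1`.

THE LINE (`ν` general; `E(t) := √(T−t)‖∇u(t)‖²₂`, `M(t) := √(ν/(T−t))`).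
(S1, frame) Enstrophy identity `d/dt‖∇u‖² = −2ν‖Δu‖² + 2∫((u·∇)u)·Δu`, pointwise Hölder
`|(u·∇)u| ≤ ‖u‖|∇u|_F = M|∇u|_F − (M − ‖u‖)|∇u|_F` with the SIGNED slack kept, Cauchy–Schwarz and Young
`2M‖∇u‖‖Δu‖ − 2ν‖Δu‖² ≤ M²‖∇u‖²/(2ν) = ‖∇u‖²/(2(T−t))` give, in the rate regime at collapse Reynolds
number ONE, `dE/dt ≤ −2√(T−t)·S_M(t)`, `S_M(t) = ∫(M(t) − ‖u‖)|∇u|_F‖Δu‖ ≥ 0`, hence the slack budget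
`∫_{t₀}^{T} √(T−t) S_M(t) dt ≤ E(t₀)/2 < ∞` (this is exactly the saturated `q = 2` edge of
`Negative/BudgetCeiling.lean`, `enstrophy_budget_saturated`: the line is the equality-case analysis).
(S2) The parabolic zoom `Z_k(t,x) = (Λ_k/ν)·u(T + Λ_k²t/ν, x₀ + Λ_k x)`, `Λ_k ↓ 0`, at a point `x₀`
converges along a subsequence, slice-wise in `C²_loc`, to a Type-I ancient mild field `v` with constant
`1` (KNSS compactness + Prop. 4.1 bounds, all in tree). (S3) At the concentration point `x₀` the limit
inherits the `L³` concentration `γ ≤ ∫_{B(0,ρ√(−t))}‖v(t)‖³` and the Morrey bound `r⁻¹∫_{B_r(y)}‖v(t)‖² ≤ A`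
for ALL `r > 0`. (S4) The budget density is zoom-invariant (`∫∫ D_{Z_k} = ν^{−3/2} ×` the `u`-budget
over the window `(T + Λ_k²a/ν, T + Λ_k²b/ν) → 0`), so Fatou gives `D_v ≡ 0`:
`(1/√(−t) − ‖v(t,x)‖)·|∇v(t,x)|_F·‖Δv(t,x)‖ = 0` everywhere. (S5) Slices of `v` are real-analytic.
(S6) STATIC RIGIDITY: a real-analytic `w : ℝ³ → ℝ³` with `(m − ‖w‖)|∇w|_F‖Δw‖ ≡ 0`, `m > 0`, and a
Morrey bound for all radii vanishes identically (identity theorem: `‖w‖ ≡ m` or `∇w ≡ 0` or `Δw ≡ 0`;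
each is killed by `r⁻¹∫_{B_r}‖w‖² ≤ A`, the harmonic case by the mean-value property / heat-flow
invariance). Composition: at `t = −1`, S6 gives `v(−1) ≡ 0`, contradicting S3's concentration.

Disproof.lean (gen-2) USED: `rungReynoldsOne_false_without_LerayHopf`,
`rung_false_with_weak_for_LerayHopf` — the energy CLASS is used at S1 (finite enstrophy, Tao's
`H^k` bounds) and at S2/S3 (Oseen-mild zoom `typeIZoom_oseen_pairs`; `TypeIConcentration` /
`ScaledEnergyBound` are local-ENERGY statements), and the KNSS parasitic drifts `u = g(t)e₀` of
`Negative/WithoutLerayHopfFalse.lean` (`drift`, zero vorticity) have ZERO budget and a CONSTANT zoom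
limit, which S6 kills only through the Morrey bound they violate — consistent;
`rungReynoldsOne_false_without_classical` — classical smoothness feeds the enstrophy identity (S1) and
the pointwise densities (S2–S4); §(c) `enstrophy_budget_saturated` / `budgetCloses_two_iff` — S1 is the
saturated `q = 2` budget, and the weight `√(T−t)` is the ONLY one for which the budget is zoom-invariant
(for `C > 1` the window budget scales like `Λ^{1−C²} → ∞`: this is honestly a rung-ONE line).
No stub is an instance refuted by a landed Negative lemma (both imported below and in the scratch check).

All stubs are stated over TREE VOCABULARY ONLY (fully inlined, no local definitions), so each can be
landed verbatim under `Summits/…/Theorems/` with `--supports stmt-NavierStokesRegularity-2882`.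
Crux FQ name for the audit:
`Summit.NavierStokesRegularity.NavierStokesRegularity.Theses.TypeICertificateLadder.RungReynoldsOne`.
-/

noncomputable section

namespace Summit.NavierStokesRegularity.NavierStokesRegularity.Cruxes.RungReynoldsOne.ConstantSpeedExclusion

open MeasureTheory Set Filter Topology
open scoped Laplacian ENNReal
open Literature.Analysis.FluidPDE
open Summit.NavierStokesRegularity.NavierStokesRegularity.Theses.TypeICertificateLadder
open Summit.NavierStokesRegularity.NavierStokesRegularity.Theorems

set_option linter.dupNamespace false

/-! ## The stubs (S1–S6) -/

/-- **S1 — the SIGNED `L^∞`-SLACK BUDGET at collapse Reynolds number one (the frame; line-specific,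
size L).** For a classical solution of Navier–Stokes (viscosity `ν`) on `ℝ³ × [0,T)`, Leray–Hopf from
its rapidly decaying datum, with the eventual rate `√(T−t)‖u(t,x)‖ ≤ √ν`, there is a time `t₀ ∈ (0,T)`
(inside the rate window) from which the weighted slack density
`D_u(t,x) = √(T−t)·(√(ν/(T−t)) − ‖u(t,x)‖)·|∇u(t,x)|_F·‖Δu(t,x)‖` has FINITE space–time integral on
`(t₀,T) × ℝ³` (stated with `∫⁻`/`ENNReal.ofReal`, so no integrability side conditions are hidden; the
density is `≥ 0` on the rate window). NO blow-up hypothesis is needed.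
Why true: in the Clay class `u` has all `L²` Sobolev norms bounded on every `[0,T'] × ℝ³`, `T' < T`
(Tao 2013 Thm 5.4: `tao2011_hasBoundedSobolevNormsOn_holds`; pressure likewise), so
`Z(t) = ∫|∇u(t)|²_F` is finite and differentiable on `(0,T)` with
`Z' = −2ν‖Δu‖²₂ + 2∫⟪(u·∇)u, Δu⟫` (`∫⟪Δu, ∇p⟫ = 0`; the computation of
`integral_sum_inner_fderiv_le_of_momentum` in `EnstrophyGronwall.lean`, keeping the slack instead of
discarding it); pointwise `|⟪(u·∇)u, Δu⟫| ≤ ‖u‖|∇u|_F‖Δu‖ = M|∇u|_F‖Δu‖ − (M − ‖u‖)|∇u|_F‖Δu‖` with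
`M(t) = √(ν/(T−t)) ≥ ‖u(t,·)‖` on the rate window; Cauchy–Schwarz and Young
`2M‖∇u‖₂‖Δu‖₂ − 2ν‖Δu‖₂² ≤ M²Z/(2ν) = Z/(2(T−t))`; so `E(t) = √(T−t)Z(t)` has
`E' = −Z/(2√(T−t)) + √(T−t)Z' ≤ −2√(T−t)S_M(t)`, `S_M = ∫(M − ‖u‖)|∇u|_F‖Δu‖ ≥ 0`, and integrating on
`[t₀,T']`, `T' ↑ T`, with `E ≥ 0`: `∫_{t₀}^{T}√(T−t)S_M ≤ E(t₀)/2` (monotone convergence; Tonelli for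
the iterated `∫⁻`). This is the `q = 2` budget at its saturation edge (`enstrophy_budget_saturated`).
Honours `rungReynoldsOne_false_without_LerayHopf` (finite enstrophy = energy class) and
`rungReynoldsOne_false_without_classical`. [Leans on: `tao2011_hasBoundedSobolevNormsOn_holds`,
`eLpNorm_uncurry_top_lt_top_of_tao2011`, `lintegral_frobeniusNormSq_fderiv_le_mul_exp` (pattern),
`integral_sum_inner_fderiv_le_of_momentum`, `IsClassicalNSSolutionOn.momentum`, `frobeniusNormSq`,
Mathlib `InnerProductSpace.laplacian` API, `MeasureTheory.lintegral_lintegral`, `hasDerivAt` of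
parametric integrals.] -/
theorem stub_slackBudget :
    ∀ (ν T : ℝ), 0 < ν → 0 < T →
      ∀ (u : ℝ → EuclideanSpace ℝ (Fin 3) → EuclideanSpace ℝ (Fin 3))
        (p : ℝ → EuclideanSpace ℝ (Fin 3) → ℝ),
        IsClassicalNSSolutionOn (Set.Ico 0 T) ν 0 u p →
        IsLerayHopfOn T ν 0 (u 0) u →
        HasRapidSpatialDecay (u 0) →
        (∀ᶠ t in 𝓝[<] T, ∀ x, Real.sqrt (T - t) * ‖u t x‖ ≤ Real.sqrt ν) →
        ∃ t₀ ∈ Set.Ioo 0 T,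
          (∫⁻ t in Set.Ioo t₀ T, ∫⁻ x, ENNReal.ofReal (Real.sqrt (T - t) *
              ((Real.sqrt (ν / (T - t)) - ‖u t x‖) *
                (Real.sqrt (frobeniusNormSq (fderiv ℝ (u t) x)) * ‖(Δ (u t)) x‖)))) < ⊤ := by
  sorry

/-- **S2 — the TYPE-I ZOOM AT A POINT with slice-wise `C²_loc` convergence (infrastructure, size XL;
the formally heaviest stub).** For a classical Leray–Hopf rapidly-decaying-datum solution with the
eventual rate `√(T−t)‖u‖ ≤ √ν` and ANY point `x₀`, some sequence of scales `Λ_k > 0`, `Λ_k → 0`, makes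
the parabolic zooms `Z_k(t,x) = (Λ_k/ν)·u(T + Λ_k²t/ν, x₀ + Λ_k x)` (viscosity normalised to `1`,
rate constant still `1`: `√(−t)‖Z_k(t,x)‖ ≤ 1` once `T + Λ_k²t/ν` lies in the rate window) converge at
EVERY `t < 0`, locally uniformly in `x` together with their first derivatives and Laplacians, to a
Type-I ancient mild field `v` with constant `1` (`IsTypeIAncientMild 1 v`: jointly smooth on `t < 0`,
divergence free, Oseen-mild between all pairs of negative times, `‖v(t,x)‖ ≤ 1/√(−t)`). No blow-up
hypothesis is needed (without blow-up the limit may vanish).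
Why true: `Z_k` is classical (`ν = 1`) on `(−νT/Λ_k², 0)` (`IsClassicalNSSolutionOn.stRescale`,
pattern of `typeIZoom_unit_viscosity`), Oseen-mild between all pairs of times there
(`typeIZoom_oseen_pairs` transported by `ClassicalSolutionRescale` / `NSLerayHopfABCScaling`), with the
rate `√(−τ)‖Z_k τ x‖ ≤ 1` on `(A_k, 0)`, `A_k = −ν(T−t₁)/Λ_k² → −∞` (`t₁` = onset of the rate);
`typeIZoom_compactness` (KNSS 2009 Lemma 6.1) extracts a subsequence converging slice-wise locally
uniformly to a jointly continuous, weakly divergence-free, Oseen-mild `W` with `√(−t)‖W‖ ≤ 1`, which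
is in the class by KNSS Prop. 4.1 smoothing (`contDiffOn_of_Ioo`-type upgrade, `heatFlow_of_pos`);
the derivative upgrade: the `x`-derivatives of order `≤ 3` of `Z_{φ k}(t,·)` and of `v(t,·)` are
bounded uniformly in `k ≥ k₀(t)` on every slice (`exists_norm_iteratedFDeriv_le_of_typeI_Ioo`, KNSS
(4.10)), so slice-wise `C⁰_loc` convergence upgrades to `C²_loc` by Landau–Kolmogorov interpolation on
balls (or by a second Arzelà–Ascoli extraction, `exists_strictMono_tendstoUniformlyOn_of_bound`,
and `hasFDerivAt_of_tendstoLocallyUniformlyOn`); `Δ = tr ∇²`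
(`laplacian_eq_iteratedFDeriv_stdOrthonormalBasis`). Re-index `Λ` along the subsequence. Honours
`rung_false_with_weak_for_LerayHopf` (mildness of the zooms is where the energy class enters).
[Leans on: `typeIZoom_compactness`, `typeIZoom_oseen_pairs`, `typeIZoom_unit_viscosity` (pattern),
`Target.Negative.pointwise_bounded_before`, `exists_norm_iteratedFDeriv_le_of_typeI_Ioo`,
`contDiffOn_of_Ioo`, `isTypeIAncientMild_iff`, `heatFlow_of_pos`, `exists_holder_quarter_of_oseenMild`,
Mathlib `TendstoLocallyUniformly`, `ContinuousLinearMap.iteratedFDeriv_comp_right`.] -/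
theorem stub_typeIZoomC2 :
    ∀ (ν T : ℝ), 0 < ν → 0 < T →
      ∀ (u : ℝ → EuclideanSpace ℝ (Fin 3) → EuclideanSpace ℝ (Fin 3))
        (p : ℝ → EuclideanSpace ℝ (Fin 3) → ℝ),
        IsClassicalNSSolutionOn (Set.Ico 0 T) ν 0 u p →
        IsLerayHopfOn T ν 0 (u 0) u →
        HasRapidSpatialDecay (u 0) →
        (∀ᶠ t in 𝓝[<] T, ∀ x, Real.sqrt (T - t) * ‖u t x‖ ≤ Real.sqrt ν) →
        ∀ x₀ : EuclideanSpace ℝ (Fin 3),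
          ∃ (Λ : ℕ → ℝ) (v : ℝ → EuclideanSpace ℝ (Fin 3) → EuclideanSpace ℝ (Fin 3)),
            (∀ k, 0 < Λ k) ∧ Filter.Tendsto Λ Filter.atTop (𝓝 0) ∧ IsTypeIAncientMild 1 v ∧
            ∀ t < 0,
              TendstoLocallyUniformly
                  (fun k x => (Λ k / ν) • u (T + Λ k ^ 2 * t / ν) (x₀ + Λ k • x)) (v t)
                  Filter.atTop ∧
                TendstoLocallyUniformly
                  (fun k => fderiv ℝ (fun x => (Λ k / ν) • u (T + Λ k ^ 2 * t / ν) (x₀ + Λ k • x)))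
                  (fderiv ℝ (v t)) Filter.atTop ∧
                TendstoLocallyUniformly
                  (fun k => Δ (fun x => (Λ k / ν) • u (T + Λ k ^ 2 * t / ν) (x₀ + Λ k • x)))
                  (Δ (v t)) Filter.atTop := by
  sorry

/-- **S3 — the zoom limit at the CONCENTRATION POINT inherits `L³` concentration and the Morrey bound
for ALL radii (size M).** If `x₀` carries the eventual scale-invariant concentration
`γν³ ≤ ∫_{B(x₀, ρ√(ν(T−t)))}‖u(t)‖³` (the shape of the route's `TypeIConcentration`) and `u` has the
eventual uniform Morrey bound `r⁻¹∫_{B_r(y)}‖u(t)‖² ≤ Aν²` for `0 < r ≤ r₀` (the shape of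
`ScaledEnergyBound`), then any slice-wise locally uniform limit `v` of the zooms `Z_k` of S2 at `x₀`
satisfies `γ ≤ ∫_{B(0, ρ√(−t))}‖v(t)‖³` and `r⁻¹∫_{B_r(y)}‖v(t)‖² ≤ A` for EVERY `t < 0`, `y`, `r > 0`.
Why true: change of variables `x' = x₀ + Λ_k x` at `t' = T + Λ_k²t/ν ↑ T`:
`∫_{B(0,ρ√(−t))}‖Z_k(t)‖³ = ν⁻³∫_{B(x₀,ρ√(ν(T−t')))}‖u(t')‖³ ≥ γ` and
`r⁻¹∫_{B_r(y)}‖Z_k(t)‖² = ν⁻²(Λ_k r)⁻¹∫_{B_{Λ_k r}(x₀+Λ_k y)}‖u(t')‖² ≤ A` as soon as `t'` is in both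
eventual windows and `Λ_k r ≤ r₀` (i.e. for `k` large, `Λ_k → 0`); the slices `u(t')` are continuous
(classical), the convergence is uniform on the compact closed balls, so the integrals converge and the
inequalities pass to the limit. (No sign conditions on `ρ, γ, A` are needed.)
[Leans on: `IsClassicalNSSolutionOn.contDiff_velocity`, Mathlib `MeasureTheory.integral_comp_smul`
/ `Measure.addHaar_smul`, `setIntegral_map` under `x ↦ x₀ + Λ • x` (`Metric.ball` preimages:
`smul_ball`, `preimage_add_ball`), `TendstoLocallyUniformly.tendstoUniformlyOn` on compacts,
`intervalIntegral`/`tendsto_integral_of_tendstoUniformlyOn`-type dominated convergence,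
`mem_nhdsLT_iff_exists_Ioo_subset`, `le_of_tendsto'`.] -/
theorem stub_zoomInheritsMorreyConcentration :
    ∀ (ν T : ℝ), 0 < ν → 0 < T →
      ∀ (u : ℝ → EuclideanSpace ℝ (Fin 3) → EuclideanSpace ℝ (Fin 3))
        (p : ℝ → EuclideanSpace ℝ (Fin 3) → ℝ),
        IsClassicalNSSolutionOn (Set.Ico 0 T) ν 0 u p →
        ∀ (x₀ : EuclideanSpace ℝ (Fin 3)) (ρ γ A r₀ : ℝ), 0 < r₀ →
          (∀ᶠ t in 𝓝[<] T, γ * ν ^ 3 ≤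
              ∫ x in Metric.ball x₀ (ρ * Real.sqrt (ν * (T - t))), ‖u t x‖ ^ 3) →
          (∀ᶠ t in 𝓝[<] T, ∀ y : EuclideanSpace ℝ (Fin 3), ∀ r : ℝ, 0 < r → r ≤ r₀ →
              r⁻¹ * (∫ x in Metric.ball y r, ‖u t x‖ ^ 2) ≤ A * ν ^ 2) →
          ∀ (Λ : ℕ → ℝ) (v : ℝ → EuclideanSpace ℝ (Fin 3) → EuclideanSpace ℝ (Fin 3)),
            (∀ k, 0 < Λ k) → Filter.Tendsto Λ Filter.atTop (𝓝 0) →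
            (∀ t < 0, TendstoLocallyUniformly
                (fun k x => (Λ k / ν) • u (T + Λ k ^ 2 * t / ν) (x₀ + Λ k • x)) (v t)
                Filter.atTop) →
            (∀ t < 0, γ ≤ ∫ x in Metric.ball (0 : EuclideanSpace ℝ (Fin 3)) (ρ * Real.sqrt (-t)),
                ‖v t x‖ ^ 3) ∧
            (∀ t < 0, ∀ y : EuclideanSpace ℝ (Fin 3), ∀ r : ℝ, 0 < r →
                r⁻¹ * (∫ x in Metric.ball y r, ‖v t x‖ ^ 2) ≤ A) := by
  sorry

/-- **S4 — the FATOU LEVER: the zoom limit is SLACK-FREE (size M).** If the `u`-budget of S1 is finite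
from some `t₀ < T` on (so that the zoom windows eventually lie inside `(t₀, T)`), `v` is a Type-I ancient mild field (constant `1`) and the zooms `Z_k` at `x₀` converge to
`v` slice-wise in `C²_loc` as in S2, then at every `t < 0` and every `x`
`(1/√(−t) − ‖v(t,x)‖)·|∇v(t,x)|_F·‖Δv(t,x)‖ = 0` — wherever the limit has a non-zero gradient and a
non-zero Laplacian it moves at the MAXIMAL speed `1/√(−t)` allowed by the rate.
Why true: the density is zoom-INVARIANT: with `t' = T + Λ_k²t/ν`, `x' = x₀ + Λ_k x` one has
`∇Z_k = (Λ_k²/ν)∇u`, `ΔZ_k = (Λ_k³/ν)Δu`, `1/√(−t) − ‖Z_k‖ = (Λ_k/ν)(√(ν/(T−t')) − ‖u‖)`,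
`√(−t) = √(ν(T−t'))/Λ_k`, `dx dt = Λ_k⁻³(ν/Λ_k²)dx'dt'`, hence
`∫_{(a,b)}∫ D_{Z_k} = ν^{−3/2} ∫_{(T+Λ_k²a/ν, T+Λ_k²b/ν)}∫ D_u → 0` (a finite `∫⁻` over windows shrinking
to `T`: `exists_pos_setLIntegral_lt_of_measure_lt`); by S2's convergences `D_{Z_k}(t,x) → D_v(t,x)`
pointwise (`ENNReal.ofReal` continuous), so Fatou (`lintegral_liminf_le`, twice, after discarding the
finitely many `k` whose window leaves `(0,T)`) gives `∫_{(a,b)}∫ ofReal(D_v) = 0`; `D_v ≥ 0` because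
`‖v(t,x)‖ ≤ 1/√(−t)` (`HasTypeITimeDecay 1`), and `D_v` is jointly continuous on the open slab (joint
smoothness of `v`), so `D_v ≡ 0`; divide by `√(−t) > 0`.
[Leans on: `IsTypeIAncientMild` (clauses 1 and 4), `IsClassicalNSSolutionOn.contDiff_velocity`,
chain rule `fderiv_comp`/`ContinuousLinearMap.iteratedFDeriv_comp_right` for the affine zoom,
`laplacian_eq_iteratedFDeriv_stdOrthonormalBasis`, Mathlib `lintegral_liminf_le`,
`MeasureTheory.lintegral_map`/`Measure.addHaar_smul` (change of variables), `lintegral_lintegral`,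
`exists_pos_setLIntegral_lt_of_measure_lt`, `ae_iff`/`Continuous.ae_eq_iff_eq`.] -/
theorem stub_zoomSlackFree :
    ∀ (ν T : ℝ), 0 < ν → 0 < T →
      ∀ (u : ℝ → EuclideanSpace ℝ (Fin 3) → EuclideanSpace ℝ (Fin 3))
        (p : ℝ → EuclideanSpace ℝ (Fin 3) → ℝ),
        IsClassicalNSSolutionOn (Set.Ico 0 T) ν 0 u p →
        ∀ t₀ : ℝ, t₀ < T →
          (∫⁻ t in Set.Ioo t₀ T, ∫⁻ x, ENNReal.ofReal (Real.sqrt (T - t) *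
              ((Real.sqrt (ν / (T - t)) - ‖u t x‖) *
                (Real.sqrt (frobeniusNormSq (fderiv ℝ (u t) x)) * ‖(Δ (u t)) x‖)))) < ⊤ →
          ∀ (x₀ : EuclideanSpace ℝ (Fin 3)) (Λ : ℕ → ℝ)
            (v : ℝ → EuclideanSpace ℝ (Fin 3) → EuclideanSpace ℝ (Fin 3)),
            (∀ k, 0 < Λ k) → Filter.Tendsto Λ Filter.atTop (𝓝 0) → IsTypeIAncientMild 1 v →
            (∀ t < 0,
              TendstoLocallyUniformly
                  (fun k x => (Λ k / ν) • u (T + Λ k ^ 2 * t / ν) (x₀ + Λ k • x)) (v t)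
                  Filter.atTop ∧
                TendstoLocallyUniformly
                  (fun k => fderiv ℝ (fun x => (Λ k / ν) • u (T + Λ k ^ 2 * t / ν) (x₀ + Λ k • x)))
                  (fderiv ℝ (v t)) Filter.atTop ∧
                TendstoLocallyUniformly
                  (fun k => Δ (fun x => (Λ k / ν) • u (T + Λ k ^ 2 * t / ν) (x₀ + Λ k • x)))
                  (Δ (v t)) Filter.atTop) →
            ∀ t < 0, ∀ x,
              ((Real.sqrt (-t))⁻¹ - ‖v t x‖) *
                  (Real.sqrt (frobeniusNormSq (fderiv ℝ (v t) x)) * ‖(Δ (v t)) x‖) = 0 := by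
  sorry

/-- **S5 — Type-I ancient mild fields have REAL-ANALYTIC slices (size M; known, in-tree inputs).**
For every `t < 0` the slice `v(t,·)` of a Type-I ancient mild field is real-analytic on all of `ℝ³`.
Why true: fix `t < 0`; on `(2t, t/2)` the field is bounded by `M = C/√(−t/2)`; pick a restart time
`s ∈ (2t, t)` with `t − s < ε/M²` (`ε` of the PROVED local fact
`lemarieRieusset2016_local_analyticity_holds`, `ν = 1`): the local solution `vl` from the bounded
continuous datum `v(s)` is jointly real-analytic on `(s, s + ε/M²) × ℝ³` and solves
`vl(τ) = e^{(τ−s)Δ}v(s) − B¹_s(vl,vl)(τ)` there, as does `v` (clause 3 of `IsTypeIAncientMild`,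
`heatFlow_of_pos`); essentially bounded Oseen-mild solutions from the same datum are unique
(`oseenMild_essBounded_unique`), so `v = vl` on the window (both continuous), and the slice at `t` is
analytic (`analyticOnNhd_slice`). (For `C < 0` the class is empty; for the zero field trivial.)
[Leans on: `lemarieRieusset2016_local_analyticity_holds`, `oseenMild_essBounded_unique`,
`analyticOnNhd_slice`, `isTypeIAncientMild_iff`, `heatFlow_of_pos`, `IsTypeIAncientMild` clauses,
Mathlib `AnalyticOnNhd.comp`.] -/
theorem stub_analyticSlices :
    ∀ (C : ℝ) (v : ℝ → EuclideanSpace ℝ (Fin 3) → EuclideanSpace ℝ (Fin 3)),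
      IsTypeIAncientMild C v → ∀ t < 0, AnalyticOnNhd ℝ (v t) Set.univ := by
  sorry

/-- **S6 — STATIC SLACK RIGIDITY under a Morrey bound (the equality-case rigidity of the line,
size M).** A real-analytic field `w : ℝ³ → ℝ³` whose `L^∞`-slack density against a level `m > 0`
vanishes identically, `(m − ‖w(x)‖)·|∇w(x)|_F·‖Δw(x)‖ = 0` for all `x`, and which obeys a Morrey bound
`r⁻¹∫_{B_r(y)}‖w‖² ≤ A` for ALL centres and radii, is identically zero.
Why true: `F = (m² − ‖w‖²)·|∇w|²_F·‖Δw‖²` is real-analytic (`AnalyticOnNhd.fderiv`,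
`AnalyticOnNhd.iteratedFDeriv`, inner products and `frobeniusNormSq` are polynomial) and vanishes
identically, so by the identity theorem on the connected `ℝ³`
(`AnalyticOnNhd.eqOn_zero_of_preconnected_of_eventuallyEq_zero`: if `f·g ≡ 0` and `f ≢ 0` then `g`
vanishes on the non-empty open set `{f ≠ 0}`, hence everywhere) one factor vanishes identically:
(i) `‖w‖ ≡ m`: then `r⁻¹∫_{B_r(0)}m² = (4π/3)m²r² ≤ A` for all `r` — absurd (`EuclideanSpace.volume_ball`
/ `InnerProductSpace.volume_ball`); (ii) `∇w ≡ 0`: `w ≡ b` constant (`is_const_of_fderiv_eq_zero`),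
and `b ≠ 0` is absurd as in (i); (iii) `Δw ≡ 0`: each component is harmonic with
`∫_{B_r(y)}‖w‖² ≤ Ar`, so by the mean-value property `‖w(y)‖² ≤ ⨍_{B_r(y)}‖w‖² ≤ 3A/(4πr²) → 0`
(alternatively: `e^{τΔ}w = w` for harmonic `w` of polynomial growth, `heatExtension` facts in tree, and
`|e^{τΔ}w(y)|² ≤ ∫Φ_τ(y−z)‖w(z)‖²dz ≲ Aτ^{−1/2} → 0`). The constant-speed alternative (i) is the card's
"constant speed `|U| ≡ 1`" branch, excluded here by the Morrey bound in one line; the card's Bernoulli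
/ BMO lemma `NoConstantSpeedAncientMild` is the Morrey-free alternative and is NOT needed.
[Leans on: Mathlib `AnalyticOnNhd.eqOn_zero_of_preconnected_of_eventuallyEq_zero`,
`AnalyticOnNhd.fderiv`, `AnalyticOnNhd.iteratedFDeriv`, `ContinuousLinearMap.analyticOnNhd`,
`laplacian_eq_iteratedFDeriv_stdOrthonormalBasis`, `is_const_of_fderiv_eq_zero`,
`EuclideanSpace.volume_ball`, `isPreconnected_univ`; tree `frobeniusNormSq_eq_sum`,
`UnboundedOperators.heatExtension` API for route (iii).] -/
theorem stub_slackRigidity :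
    ∀ (w : EuclideanSpace ℝ (Fin 3) → EuclideanSpace ℝ (Fin 3)) (m A : ℝ), 0 < m →
      AnalyticOnNhd ℝ w Set.univ →
      (∀ y : EuclideanSpace ℝ (Fin 3), ∀ r : ℝ, 0 < r →
          r⁻¹ * (∫ x in Metric.ball y r, ‖w x‖ ^ 2) ≤ A) →
      (∀ x, (m - ‖w x‖) * (Real.sqrt (frobeniusNormSq (fderiv ℝ w x)) * ‖(Δ w) x‖) = 0) →
      ∀ x, w x = 0 := by
  sorry

/-! ## The composition -/

/-- **`RungReynoldsOne` from S1–S6** (kernel-checked; concludes the crux BY NAME). Suppose a rung-one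
solution did not extend. The route's PROVED items at `C = 1` give a concentration point `x₀` with
constants `ρ, γ > 0` (`typeIConcentration_proof`, stmt-2881) and the uniform Morrey bound with constants
`A, r₀` (`scaledEnergyBound_proof`, stmt-2884). S1 gives the finite slack budget from some `t₀`; S2 the
zoom limit `v` at `x₀` (Type-I ancient mild, constant `1`) with slice-wise `C²_loc` convergence; S3
transports concentration and the Morrey bound (all radii) to `v`; S4 makes `v` slack-free; S5 makes
the slice `v(−1)` real-analytic; S6 (with `m = 1/√1`) forces `v(−1) ≡ 0`, so the concentration
integral at `t = −1` vanishes, contradicting `γ > 0`. -/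
theorem RungReynoldsOne_of : RungReynoldsOne := by
  intro ν T hν hT u p hcl hLH hdec hrate
  by_contra hext
  -- the rate in the ladder's `C * √ν` form with `C = 1`
  have hrate1 : ∀ᶠ t in 𝓝[<] T, ∀ x, Real.sqrt (T - t) * ‖u t x‖ ≤ 1 * Real.sqrt ν :=
    hrate.mono fun t ht x => by rw [one_mul]; exact ht x
  -- the two PROVED route items at `C = 1`
  obtain ⟨ρ, hρ, γ, hγ, hconc⟩ := typeIConcentration_proof 1 one_pos
  obtain ⟨x₀, hx₀⟩ := hconc ν T hν hT u p hcl hLH hdec hrate1 hext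
  obtain ⟨A, hA⟩ := scaledEnergyBound_proof 1 one_pos
  obtain ⟨r₀, hr₀, hmor⟩ := hA ν T hν hT u p hcl hLH hdec hrate1
  -- S1: the slack budget; S2: the zoom at the concentration point
  obtain ⟨t₀, ht₀, hbudget⟩ := stub_slackBudget ν T hν hT u p hcl hLH hdec hrate
  obtain ⟨Λ, v, hΛpos, hΛ0, hclass, hconv⟩ := stub_typeIZoomC2 ν T hν hT u p hcl hLH hdec hrate x₀
  -- S3: concentration and Morrey pass to the limit
  obtain ⟨hconcv, hmorv⟩ := stub_zoomInheritsMorreyConcentration ν T hν hT u p hcl x₀ ρ γ A r₀ hr₀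
    hx₀ hmor Λ v hΛpos hΛ0 (fun t ht => (hconv t ht).1)
  -- S4: the limit is slack-free; S5: its slices are analytic; S6: the slice at `t = -1` vanishes
  have hslack := stub_zoomSlackFree ν T hν hT u p hcl t₀ ht₀.2 hbudget x₀ Λ v hΛpos hΛ0 hclass hconv
  have hneg1 : (-1 : ℝ) < 0 := by norm_num
  have han := stub_analyticSlices 1 v hclass (-1) hneg1
  have hm : (0 : ℝ) < (Real.sqrt (-(-1 : ℝ)))⁻¹ := by
    rw [neg_neg, Real.sqrt_one, inv_one]; exact one_pos
  have hzero : ∀ x, v (-1) x = 0 :=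
    stub_slackRigidity (v (-1)) ((Real.sqrt (-(-1 : ℝ)))⁻¹) A hm han (hmorv (-1) hneg1)
      (hslack (-1) hneg1)
  -- contradiction with concentration at `t = -1`
  have hc := hconcv (-1) hneg1
  have hint : (∫ x in Metric.ball (0 : EuclideanSpace ℝ (Fin 3)) (ρ * Real.sqrt (-(-1 : ℝ))),
      ‖v (-1) x‖ ^ 3) = 0 := by
    simp [hzero]
  rw [hint] at hc
  exact absurd hc (not_le.mpr hγ)

end Summit.NavierStokesRegularity.NavierStokesRegularity.Cruxes.RungReynoldsOne.ConstantSpeedExclusion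

end
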